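import Summits.AtomisticToContinuum.FouriersLaw.Theorems.HoelderEscapeProfileAbelSpreadCeilingAbelExchangeToolkit
import HarnessLib

/-!
# Stub `stub_abelExchange` of line `regularity_collapse`, crux `HoelderEscapeProfile.AbelSpreadCeiling`
(item stmt-AtomisticToContinuum-16010; `--supports` file, closes nothing; PURE REAL ANALYSIS, Mathlib only)

WHAT. Registered stub 6 of the crux's skeleton (`Cruxes/AbelSpreadCeiling/Lines/regularity_collapse.lean`): the
dynamics-free ABEL EXCHANGE across `Σ_x` and `∫dt` without absolute space-time convergence. For sequences of
functions `S, G : ℤ → ℝ → ℝ` and `ν > 0` with (i) the per-site twice-integrated conservation law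
`S(x,t) − S(x,0) = ∫_{(0,t]} (t−u) (ΔG)(x,u) du`, (ii) `e^{−νt}S(x,·) ∈ L¹(0,∞)`, (iii) `Σ_x (1+x²)|S̄_ν(x)| < ∞`
(`S̄_ν(x) = ν∫₀^∞ e^{−νt}S(x,t)dt`), (iv) `Σ_x (1+x²)|S(x,0)| < ∞`, (v) each `G(x,·)` continuous,
(vi) `Σ_x |G(x,u)| < ∞` at every `u`, (vii) `e^{−νu}Σ_x|G(x,u)| ∈ L¹(0,∞)`:
`Σ_x x² S̄_ν(x) = Σ_x x² S(x,0) + (2/ν) ∫₀^∞ e^{−νu} Σ_x G(x,u) du`.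

HOW (toolkit in `Theorems/HoelderEscapeProfileAbelSpreadCeilingAbelExchangeToolkit.lean`). With the cut-off weights
`c_L` (`exists_cutoff`: `c_L = x²` on `|x| ≤ L`, `|c_L| ≤ 11x²`, `|Δc_L| ≤ 10`, `Δc_L → 2`, finite support) and the
finite current sums `g_L(u) = Σ_x Δc_L(x) G(x,u)` (continuous, `|g_L| ≤ 10Σ_x|G(·,u)|`, `g_L(u) → 2Σ_xG(x,u)`):
finite exchange `Σ_x c_L(x)S̄_ν(x) = ν∫₀^∞e^{−νt}Σ_x c_L(x)S(x,t)dt`; (i) + summation by parts give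
`Σ_x c_L(x)S(x,t) = Σ_x c_L(x)S(x,0) + ∫_{(0,t]}(t−u)g_L(u)du`; the Laplace transform of the double primitive
(`stub_abelExchangeLaplace`, dominated through (vii)) gives `Σ_x c_LS̄_ν = Σ_x c_LS(·,0) + ν⁻¹∫₀^∞e^{−νu}g_L(u)du`
for every `L`; finally `L → ∞` by dominated convergence in `x` ((iii), (iv), Tannery) and in `u` ((vi), (vii)),
and uniqueness of limits.
-/

noncomputable section

namespace Summit.AtomisticToContinuum.FouriersLaw.Theorems.AbelSpreadCeiling.RegularityCollapse

open MeasureTheory Filter Set Function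
open scoped Topology BigOperators

open AbelExchange in
/-- **Stub `stub_abelExchange` (registered signature, verbatim): the dynamics-free Abel exchange.** For
`S, G : ℤ → ℝ → ℝ`, `ν > 0` with (i) `S(x,t) − S(x,0) = ∫_{(0,t]}(t−u)(G(x+1,u) − 2G(x,u) + G(x−1,u))du` (`t > 0`),
(ii) `e^{−νt}S(x,·) ∈ L¹(0,∞)`, (iii) `Σ_x(1+x²)|ν∫₀^∞e^{−νt}S(x,t)dt| < ∞`, (iv) `Σ_x(1+x²)|S(x,0)| < ∞`,
(v) `G(x,·)` continuous, (vi) `Σ_x|G(x,u)| < ∞` for all `u`, (vii) `e^{−νu}Σ_x|G(x,u)| ∈ L¹(0,∞)`: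
`Σ_x x²·ν∫₀^∞e^{−νt}S(x,t)dt = Σ_x x²S(x,0) + (2/ν)∫₀^∞e^{−νu}Σ_xG(x,u)du`. Proof: cut-off weights `c_L`
(`exists_cutoff`), finite exchange, (i) + summation by parts, Laplace transform of the double primitive
(`stub_abelExchangeLaplace`), and `L → ∞` by dominated convergence in `x` and in `u`. [folklore] -/
theorem stub_abelExchange :
    ∀ (S G : ℤ → ℝ → ℝ) (ν : ℝ), 0 < ν → (∀ x : ℤ, ∀ t : ℝ, 0 < t → S x t - S x 0 = ∫ u in Set.Ioc (0:ℝ) t, (t - u) * (G (x + 1) u - 2 * G x u + G (x - 1) u)) → (∀ x : ℤ, MeasureTheory.IntegrableOn (fun t : ℝ => Real.exp (-(ν * t)) * S x t) (Set.Ioi 0)) → Summable (fun x : ℤ => (1 + (x : ℝ) ^ 2) * |ν * ∫ t in Set.Ioi (0:ℝ), Real.exp (-(ν * t)) * S x t|) → Summable (fun x : ℤ => (1 + (x : ℝ) ^ 2) * |S x 0|) → (∀ x : ℤ, Continuous (fun t : ℝ => G x t)) → (∀ t : ℝ, Summable (fun x : ℤ => |G x t|)) → MeasureTheory.IntegrableOn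 (fun u : ℝ => Real.exp (-(ν * u)) * ∑' x : ℤ, |G x u|) (Set.Ioi 0) → ∑' x : ℤ, (x : ℝ) ^ 2 * (ν * ∫ t in Set.Ioi (0:ℝ), Real.exp (-(ν * t)) * S x t) = (∑' x : ℤ, (x : ℝ) ^ 2 * S x 0) + 2 / ν * ∫ u in Set.Ioi (0:ℝ), Real.exp (-(ν * u)) * ∑' x : ℤ, G x u := by
  intro S G ν hν hHelf hInt hSb hS0 hGc hGs hGL
  -- the Abel profile `Sb x = ν ∫₀^∞ e^{−νt} S(x,t) dt`
  obtain ⟨Sb, hSb_def⟩ : ∃ Sb : ℤ → ℝ, ∀ x, Sb x = ν * ∫ t in Ioi (0:ℝ), Real.exp (-(ν * t)) * S x t :=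
    ⟨_, fun x => rfl⟩
  simp only [← hSb_def] at hSb ⊢
  -- the cut-off weights, the window `F L ⊇ supp c_L` and the finite current sums `g L`
  obtain ⟨c, hc_sq, hc_abs, hlap_abs, hlap_two, hc_supp⟩ := exists_cutoff
  obtain ⟨F, hF⟩ : ∃ F : ℕ → Finset ℤ, ∀ L, F L = Finset.Icc (-((4 * L + 2 : ℕ) : ℤ)) ((4 * L + 2 : ℕ) : ℤ) :=
    ⟨_, fun L => rfl⟩
  simp only [← hF] at hc_supp
  obtain ⟨g, hg⟩ : ∃ g : ℕ → ℝ → ℝ,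
      ∀ L u, g L u = ∑ x ∈ F L, (c L (x + 1) - 2 * c L x + c L (x - 1)) * G x u := ⟨_, fun L u => rfl⟩
  -- properties of `g L`: continuity, `|g L u| ≤ 10 Σ_x |G(x,u)|`, `g L u → 2 Σ_x G(x,u)`
  have g_cont : ∀ L, Continuous (g L) := fun L => by
    rw [show g L = fun u => ∑ x ∈ F L, (c L (x + 1) - 2 * c L x + c L (x - 1)) * G x u from funext (hg L)]
    exact continuous_finsetSum _ fun x _ => continuous_const.mul (hGc x)
  have g_bound : ∀ L u, |g L u| ≤ 10 * ∑' x : ℤ, |G x u| := fun L u => by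
    rw [hg]
    calc |∑ x ∈ F L, (c L (x + 1) - 2 * c L x + c L (x - 1)) * G x u|
        ≤ ∑ x ∈ F L, |(c L (x + 1) - 2 * c L x + c L (x - 1)) * G x u| := Finset.abs_sum_le_sum_abs _ _
      _ ≤ ∑ x ∈ F L, 10 * |G x u| := Finset.sum_le_sum fun x _ => by
          rw [abs_mul]
          exact mul_le_mul_of_nonneg_right (hlap_abs L x) (abs_nonneg _)
      _ = 10 * ∑ x ∈ F L, |G x u| := by rw [Finset.mul_sum]
      _ ≤ 10 * ∑' x : ℤ, |G x u| := by
          gcongr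
          exact (hGs u).sum_le_tsum (F L) fun x _ => abs_nonneg _
  have g_lim : ∀ u, Tendsto (fun L => g L u) atTop (𝓝 (2 * ∑' x : ℤ, G x u)) := fun u => by
    have e : (fun L => g L u) = fun L => ∑' x : ℤ, (c L (x + 1) - 2 * c L x + c L (x - 1)) * G x u := by
      funext L
      rw [hg]
      exact (tsum_eq_sum fun x hx => by
        rw [(hc_supp L x hx).1, (hc_supp L x hx).2.1, (hc_supp L x hx).2.2]; ring).symm
    rw [e, ← tsum_mul_left]
    refine tendsto_tsum_of_dominated_convergence
      (f := fun (L : ℕ) (x : ℤ) => (c L (x + 1) - 2 * c L x + c L (x - 1)) * G x u)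
      (bound := fun x => 10 * |G x u|) ((hGs u).mul_left 10) (fun x => ?_)
      (Eventually.of_forall fun L x => ?_)
    · refine tendsto_nhds_of_eventually_eq ?_
      filter_upwards [eventually_ge_atTop (x.natAbs + 1)] with L hL
      simp only [hlap_two L x (by omega) (by omega)]
    · rw [Real.norm_eq_abs, abs_mul]
      exact mul_le_mul_of_nonneg_right (hlap_abs L x) (abs_nonneg _)
  -- §2 applied to `g L`
  have hB : IntegrableOn (fun u : ℝ => Real.exp (-(ν * u)) * (10 * ∑' x : ℤ, |G x u|)) (Ioi 0) := by
    have h : IntegrableOn (fun u : ℝ => 10 * (Real.exp (-(ν * u)) * ∑' x : ℤ, |G x u|)) (Ioi 0) :=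
      hGL.const_mul 10
    exact h.congr_fun (fun u _ => by ring) measurableSet_Ioi
  have hLap : ∀ L : ℕ,
      IntegrableOn (fun t : ℝ => Real.exp (-(ν * t)) * ∫ u in Ioc (0:ℝ) t, (t - u) * g L u) (Ioi 0) ∧
      ∫ t in Ioi (0:ℝ), Real.exp (-(ν * t)) * ∫ u in Ioc (0:ℝ) t, (t - u) * g L u =
        1 / ν ^ 2 * ∫ u in Ioi (0:ℝ), Real.exp (-(ν * u)) * g L u := fun L =>
    stub_abelExchangeLaplace ν hν (g L) _ (g_cont L) (fun u _ => g_bound L u) hB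
  -- (i) summed against the weight, and summation by parts: `Σ c_L S(·,t) = Σ c_L S(·,0) + ∫(t−u) g_L`
  have hV : ∀ (L : ℕ) (t : ℝ), 0 < t → ∑ x ∈ F L, c L x * S x t =
      (∑ x ∈ F L, c L x * S x 0) + ∫ u in Ioc (0:ℝ) t, (t - u) * g L u := by
    intro L t ht
    have e1 : ∀ x ∈ F L, c L x * S x t = c L x * S x 0 +
        c L x * ∫ u in Ioc (0:ℝ) t, (t - u) * (G (x + 1) u - 2 * G x u + G (x - 1) u) := by
      intro x _
      rw [← hHelf x t ht]
      ring
    rw [Finset.sum_congr rfl e1, Finset.sum_add_distrib]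
    congr 1
    have hi : ∀ x ∈ F L, Integrable (fun u => c L x * ((t - u) * (G (x + 1) u - 2 * G x u + G (x - 1) u)))
        (volume.restrict (Ioc (0:ℝ) t)) := by
      intro x _
      have h1 := hGc (x + 1)
      have h2 := hGc x
      have h3 := hGc (x - 1)
      exact Continuous.integrableOn_Ioc (by fun_prop)
    calc ∑ x ∈ F L, c L x * ∫ u in Ioc (0:ℝ) t, (t - u) * (G (x + 1) u - 2 * G x u + G (x - 1) u)
        = ∑ x ∈ F L, ∫ u in Ioc (0:ℝ) t, c L x * ((t - u) * (G (x + 1) u - 2 * G x u + G (x - 1) u)) :=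
          Finset.sum_congr rfl fun x _ => (integral_const_mul _ _).symm
      _ = ∫ u in Ioc (0:ℝ) t, ∑ x ∈ F L, c L x * ((t - u) * (G (x + 1) u - 2 * G x u + G (x - 1) u)) :=
          (integral_finsetSum _ hi).symm
      _ = ∫ u in Ioc (0:ℝ) t, (t - u) * g L u := by
          refine integral_congr_ae (Eventually.of_forall fun u => ?_)
          show ∑ x ∈ F L, c L x * ((t - u) * (G (x + 1) u - 2 * G x u + G (x - 1) u)) = (t - u) * g L u
          rw [hg, ← sum_mul_laplacian_eq (hc_supp L) (fun x => G x u), Finset.mul_sum]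
          exact Finset.sum_congr rfl fun x _ => by ring
  -- the identity at fixed `L`: `Σ c_L Sb = Σ c_L S(·,0) + ν⁻¹ ∫ e^{−νu} g_L`
  have hT : ∀ L : ℕ, ∑' x : ℤ, c L x * Sb x =
      (∑' x : ℤ, c L x * S x 0) + 1 / ν * ∫ u in Ioi (0:ℝ), Real.exp (-(ν * u)) * g L u := by
    intro L
    rw [tsum_eq_sum (s := F L) fun x hx => by rw [(hc_supp L x hx).1, zero_mul],
      tsum_eq_sum (s := F L) fun x hx => by rw [(hc_supp L x hx).1, zero_mul]]
    -- finite exchange of `Σ_{x ∈ F L}` and `∫ dt`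
    have ex : ∑ x ∈ F L, c L x * Sb x =
        ν * ∫ t in Ioi (0:ℝ), Real.exp (-(ν * t)) * ∑ x ∈ F L, c L x * S x t := by
      calc ∑ x ∈ F L, c L x * Sb x
          = ∑ x ∈ F L, ν * ∫ t in Ioi (0:ℝ), c L x * (Real.exp (-(ν * t)) * S x t) :=
            Finset.sum_congr rfl fun x _ => by rw [hSb_def, integral_const_mul]; ring
        _ = ν * ∑ x ∈ F L, ∫ t in Ioi (0:ℝ), c L x * (Real.exp (-(ν * t)) * S x t) := by
            rw [Finset.mul_sum]
        _ = ν * ∫ t in Ioi (0:ℝ), ∑ x ∈ F L, c L x * (Real.exp (-(ν * t)) * S x t) := by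
            rw [integral_finsetSum _ fun x _ => (hInt x).const_mul (c L x)]
        _ = ν * ∫ t in Ioi (0:ℝ), Real.exp (-(ν * t)) * ∑ x ∈ F L, c L x * S x t := by
            congr 1
            refine integral_congr_ae (Eventually.of_forall fun t => ?_)
            show ∑ x ∈ F L, c L x * (Real.exp (-(ν * t)) * S x t) = Real.exp (-(ν * t)) * ∑ x ∈ F L, c L x * S x t
            rw [Finset.mul_sum]
            exact Finset.sum_congr rfl fun x _ => by ring
    rw [ex]
    obtain ⟨hVint, hVeq⟩ := hLap L
    have e2 : ∫ t in Ioi (0:ℝ), Real.exp (-(ν * t)) * ∑ x ∈ F L, c L x * S x t =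
        ∫ t in Ioi (0:ℝ), ((∑ x ∈ F L, c L x * S x 0) * Real.exp (-(ν * t)) +
          Real.exp (-(ν * t)) * ∫ u in Ioc (0:ℝ) t, (t - u) * g L u) :=
      setIntegral_congr_fun measurableSet_Ioi fun t ht => by
        rw [hV L t ht]
        ring
    rw [e2, integral_add
        ((GreenKuboContinuation.SpectralTrichotomy.abelFloor_integrableOn_exp_neg_mul_Ioi hν).const_mul _) hVint,
      integral_const_mul, GreenKuboContinuation.SpectralTrichotomy.abelFloor_integral_exp_neg_mul_Ioi hν, hVeq]
    field_simp
  -- the three limits `L → ∞`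
  have lim1 : Tendsto (fun L : ℕ => ∑' x : ℤ, c L x * Sb x) atTop (𝓝 (∑' x : ℤ, (x : ℝ) ^ 2 * Sb x)) :=
    tendsto_tsum_cutoff_mul c hc_sq hc_abs hSb
  have lim2 : Tendsto (fun L : ℕ => ∑' x : ℤ, c L x * S x 0) atTop (𝓝 (∑' x : ℤ, (x : ℝ) ^ 2 * S x 0)) :=
    tendsto_tsum_cutoff_mul c hc_sq hc_abs hS0
  have lim3 : Tendsto (fun L : ℕ => ∫ u in Ioi (0:ℝ), Real.exp (-(ν * u)) * g L u) atTop
      (𝓝 (∫ u in Ioi (0:ℝ), Real.exp (-(ν * u)) * (2 * ∑' x : ℤ, G x u))) := by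
    refine tendsto_integral_of_dominated_convergence
      (fun u => 10 * (Real.exp (-(ν * u)) * ∑' x : ℤ, |G x u|))
      (fun L => ?_) (hGL.const_mul 10) (fun L => Eventually.of_forall fun u => ?_)
      (Eventually.of_forall fun u => (g_lim u).const_mul _)
    · have h := g_cont L
      exact (by fun_prop : Continuous fun u => Real.exp (-(ν * u)) * g L u).aestronglyMeasurable
    · rw [Real.norm_eq_abs, abs_mul, Real.abs_exp]
      calc Real.exp (-(ν * u)) * |g L u| ≤ Real.exp (-(ν * u)) * (10 * ∑' x : ℤ, |G x u|) :=
            mul_le_mul_of_nonneg_left (g_bound L u) (Real.exp_pos _).le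
        _ = 10 * (Real.exp (-(ν * u)) * ∑' x : ℤ, |G x u|) := by ring
  -- uniqueness of limits
  have key := tendsto_nhds_unique lim1 ((lim2.add (lim3.const_mul (1 / ν))).congr fun L => (hT L).symm)
  have e3 : ∫ u in Ioi (0:ℝ), Real.exp (-(ν * u)) * (2 * ∑' x : ℤ, G x u) =
      2 * ∫ u in Ioi (0:ℝ), Real.exp (-(ν * u)) * ∑' x : ℤ, G x u := by
    rw [← integral_const_mul]
    exact integral_congr_ae (Eventually.of_forall fun u => by ring)
  rw [key, e3]
  ring

end Summit.AtomisticToContinuum.FouriersLaw.Theorems.AbelSpreadCeiling.RegularityCollapse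

end
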